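import Literature.Analysis.FluidPDE.NecasRuzickaSverakRiesz
import Literature.Analysis.FluidPDE.CKNLocalRegularityRRSGlueLR
import Literature.Analysis.FluidPDE.CKNLocalRegularityRRSStep3
import Literature.Analysis.FluidPDE.TsaiPressureGrowth
import Literature.Analysis.FluidPDE.StokesInteriorEstimateHolds
import Literature.Analysis.FluidPDE.TsaiGrowthLemmasProofs
import HarnessLib

/-!
# Nečas–Růžička–Šverák 1996, Theorem 1, from Caffarelli–Kohn–Nirenberg's Proposition 1 in
# Robinson–Rodrigo–Sadowski's form (`RRS2016.theorem15_3`)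

Analysis/FluidPDE proofs file (theorems only) in the decomposition of the named fact
`Literature.Analysis.FluidPDE.necas_ruzicka_sverak` (`SelfSimilarLiouville`; J. Nečas,
M. Růžička, V. Šverák, *On Leray's self-similar solutions of the Navier–Stokes equations*, Acta
Math. 176 (1996) 283–294, **Theorem 1**: a weak solution `U ∈ L³(ℝ³)` of Leray's profile system
(1.3) vanishes). No statement of `SelfSimilarLiouville` is touched.

## What is here (all proved)

After `NecasRuzickaSverakRiesz` (`necas_ruzicka_sverak_of_CKN :
tsai1998_profile_smooth → tsai1998_lemma32 → lemarieRieusset_epsilon_regularity →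
necas_ruzicka_sverak`) two of the three inputs are discharged in the tree:
`tsai1998_profile_smooth_holds` (`TsaiGrowthLemmasProofs`) and Tsai's Lemma 3.2 via
`tsai1998_lemma32_of_facts` (`TsaiPressureGrowth`) fed by `stokes_interior_Lr_estimate_holds`
(`StokesInteriorEstimateHolds`) and `stein1970_normalisedPressure_Lp_bound_holds`
(`NormalisedPressureLpBoundProofs`). What remains is the one-scale ε-regularity criterion
(NRŠ's Proposition 2.1 for `k = 0` = Caffarelli–Kohn–Nirenberg's Proposition 1), used only for
the *unforced* Navier–Stokes system. This file re-hangs Theorem 1 on the lightest rendering of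
that criterion in the tree, Robinson–Rodrigo–Sadowski's Thm. 15.3 (`RRS2016.theorem15_3`:
suitable pairs on a unit cylinder, `ν = 1`, `f = 0`; reduced in `CKNLocalRegularityRRS` /
`CKNLocalRegularityRRSStep3` to the named facts `RRS2016.step2_force`, `RRS2016.lemma15_12`),
instead of Lemarié-Rieusset's Thm. 14.4 (`lemarieRieusset_epsilon_regularity`: arbitrary `ν`,
force `f ∈ L^q`, arbitrary radius), whose reduction to Thm. 15.3 still lacks the absorption of a
non-solenoidal force and the covering of cylinders of aspect ratio `ν`
(`CKNLocalRegularityRRSGlueLR`, module docstring) — neither of which Theorem 1 needs: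

* `IsLerayProfile.nu_normalise` — the viscosity of a Leray profile can be normalised: if `(U, P)`
  solves (1.3) with viscosity `c² > 0` then `V(z) = c⁻¹ U(c z)`, `Q(z) = c⁻² P(c z)` solve it with
  viscosity `1` and the same `a` (Tsai 1998, §3.3, p. 39: "For simplicity we assume that `ν = 1`";
  the scaling `U(y) = √ν V(y/√ν)`, `P(y) = ν Q(y/√ν)`), with `memLp_comp_smul` (`V ∈ L³` iff
  `U ∈ L³`) and `necas_ruzicka_sverak_of_nu_one` (Theorem 1 follows from its case `ν = 1`);
* `epsilonRegularity_one_of_theorem15_3` — from `RRS2016.theorem15_3`, the conclusion of the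
  one-scale criterion for the accepted local class `IsSuitableWeakSolutionOn` at `ν = 1`, zero
  force and *every* radius: `∫∫_{Q_{r₀}(z₀)} (|u|³ + |p|^{3/2}) ≤ ε₀³ r₀²` on a cylinder whose closed
  box `[t₀ − r₁², t₀] × B̄_{r₁}(x₀)` lies in the region gives `|u| ≤ C₀ ε₀ / r₀` a.e. on
  `Q_{r₀/2}(z₀)` — exactly the hypothesis `H` of the accepted
  `IsLerayProfile.exists_forall_norm_mul_norm_le_of_oneScale` (`NecasRuzickaSverakEpsilon`).
  Proof: the local classes of the suitable solution on the compact box are the §14.3 hypotheses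
  on `Ω = Q_{r₁}(z₀)` (as in the accepted `epsilonRegularity_of_isSuitableWeakSolutionOn`); the
  Navier–Stokes scaling `w = r₀ u ∘ Φ`, `π = r₀² p ∘ Φ`, `Φ(s, y) = (t₀ + r₀² s, x₀ + r₀ y)`
  (`IsLRSuitableWeakSolutionOn.nsRescale`, Caffarelli–Kohn–Nirenberg 1982, §2) maps `Q_{r₀}(z₀)`
  onto `Q_1(0, 0)` with `∫∫_{Q_1} (|w|³ + |π|^{3/2}) = r₀⁻² ∫∫_{Q_{r₀}(z₀)} (|u|³ + |p|^{3/2}) ≤ ε₀³`;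
  `(w, π)` is a suitable pair on `Q_1(0, 0)` (`IsLRSuitableWeakSolutionOn.isSuitablePair`, the
  pressure equation coming from `div u = div f = 0`); Thm. 15.3 with `ε₀³ ≤ ε₀*` bounds `|w|` by
  `c_M ε₀` a.e. on `Q_{1/2}(0, 0) = Φ⁻¹(Q_{r₀/2}(z₀))`, i.e. `|u| ≤ c_M ε₀ / r₀` a.e. on `Q_{r₀/2}(z₀)`;
* `necas_ruzicka_sverak_nu_one_of_oneScale` — Theorem 1 at `ν = 1` from the conclusion of the
  one-scale criterion at `ν = 1` (the accepted assembly `necas_ruzicka_sverak_of_epsilonRegularity`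
  with the discharged `nrs1996_lemma31_holds`, `tsai1998_profile_smooth_holds` and
  `tsai1998_lemma32_of_facts …`, and the endgame `IsLerayProfile.eq_zero_of_growth`);
* **`necas_ruzicka_sverak_of_theorem15_3 : RRS2016.theorem15_3 → necas_ruzicka_sverak`** and
  **`necas_ruzicka_sverak_of_RRS_steps : RRS2016.step2_force → RRS2016.lemma15_12 →
  necas_ruzicka_sverak`** — the new trust base of NRŠ's Theorem 1 is
  `{RRS2016.step2_force, RRS2016.lemma15_12}` (Robinson–Rodrigo–Sadowski 2016, proof of Thm. 15.3,
  Step 2, and Lemma 15.12), shared with the tree's reduction of Lemarié-Rieusset's Thm. 14.4;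
* `necas_ruzicka_sverak_of_LR : lemarieRieusset_epsilon_regularity → necas_ruzicka_sverak` — the
  accepted chain with its two other inputs discharged, kept for the dependents of Thm. 14.4.

## References

* J. Nečas, M. Růžička, V. Šverák, *On Leray's self-similar solutions of the Navier–Stokes
  equations*, Acta Math. 176 (1996) 283–294: Proposition 2.1 (p. 284), Lemma 3.2 and its proof
  (3.3)–(3.6) (pp. 288–289), Theorem 1 (p. 291). [NecasRuzickaSverak1996]
* T.-P. Tsai, *On Leray's self-similar solutions of the Navier–Stokes equations satisfying local
  energy estimates*, Arch. Rational Mech. Anal. 143 (1998) 29–51: Lemma 3.2 (p. 39), §3.3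
  (p. 39, `ν = 1`), §5 (p. 48). [Tsai1998]
* J. C. Robinson, J. L. Rodrigo, W. Sadowski, *The three-dimensional Navier–Stokes equations*,
  CUP (2016): Def. 15.2, Thm. 15.3 (p. 220), Lemma 15.12. [RobinsonRodrigoSadowski2016]
* L. Caffarelli, R. Kohn, L. Nirenberg, *Partial regularity of suitable weak solutions of the
  Navier–Stokes equations*, Comm. Pure Appl. Math. 35 (1982) 771–831: §2 (scaling),
  Proposition 1 and Corollary 1. [CaffarelliKohnNirenberg1982]
* P. G. Lemarié-Rieusset, *The Navier–Stokes problem in the 21st century*, CRC Press (2016),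
  Thm. 14.4 (p. 505). [LemarieRieusset2016]
-/

noncomputable section

open MeasureTheory Set Filter Topology Metric Function TopologicalSpace
open scoped ENNReal NNReal RealInnerProductSpace ContDiff Laplacian InnerProductSpace

namespace Literature.Analysis.FluidPDE

/-- Local notation for physical space `ℝ³ = EuclideanSpace ℝ (Fin 3)`. -/
local notation "ℝ³" => EuclideanSpace ℝ (Fin 3)

/-! ### Normalising the viscosity of a Leray profile -/

section NuNormalise

variable {E : Type*} [NormedAddCommGroup E] [InnerProductSpace ℝ E] [FiniteDimensional ℝ E]

omit [FiniteDimensional ℝ E] in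
/-- `∇(k P(c ·))(x) = (k c) • (∇P)(c x)`. [folklore] -/
theorem gradient_const_mul_comp_smul [CompleteSpace E] (P : E → ℝ) (k c : ℝ) (x : E) :
    gradient (fun y => k * P (c • y)) x = (k * c) • gradient P (c • x) := by
  have h : (fun y => k * P (c • y)) = fun y => k • P (c • y) := rfl
  rw [h, gradient, fderiv_const_smul_comp_smul' P k c x, map_smul, gradient]

omit [FiniteDimensional ℝ E] in
/-- `div (k U(c ·))(x) = (k c) div U (c x)`. [folklore] -/
theorem divergence_const_smul_comp_smul (U : E → E) (k c : ℝ) (x : E) :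
    VectorCalculus.divergence (fun y => k • U (c • y)) x =
      (k * c) * VectorCalculus.divergence U (c • x) := by
  simp only [VectorCalculus.divergence, fderiv_const_smul_comp_smul' U k c x,
    ContinuousLinearMap.toLinearMap_smul, map_smul, smul_eq_mul]

/-- **Normalising the viscosity of a Leray profile** (Tsai 1998, §3.3, p. 39: "For simplicity we
assume that `ν = 1`", restored by the scaling `U(y) = √ν V(y/√ν)`, `P(y) = ν Q(y/√ν)` of (1.3)).
If `(U, P)` solves Leray's profile system with viscosity `c²`, `c > 0`, and rate `a`, then
`V(z) = c⁻¹ U(c z)`, `Q(z) = (c²)⁻¹ P(c z)` solve it with viscosity `1` and the same rate `a`: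
each term of the equation for `(V, Q)` at `z` is `c⁻¹` times the corresponding term for `(U, P)`
at `y = c z` (`ΔV(z) = c ΔU(y)`, `DV(z) z = c⁻¹ DU(y) y`, `DV(z) V(z) = c⁻¹ DU(y) U(y)`,
`∇Q(z) = c⁻¹ ∇P(y)`), and `div V(z) = div U(y) = 0`. [cite: Tsai1998, §3.3 (p. 39)] -/
theorem IsLerayProfile.nu_normalise {c a : ℝ} (hc : 0 < c) {U : E → E} {P : E → ℝ}
    (h : IsLerayProfile (c ^ 2) a U P) :
    IsLerayProfile 1 a (fun z => c⁻¹ • U (c • z)) (fun z => (c ^ 2)⁻¹ * P (c • z)) := by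
  have hc0 : c ≠ 0 := hc.ne'
  refine ⟨(h.contDiff_velocity.comp (contDiff_const_smul c)).const_smul c⁻¹,
    contDiff_const.mul (h.contDiff_pressure.comp (contDiff_const_smul c)), fun z => ?_, fun z => ?_⟩
  · -- the profile equation at `z`, from the one for `(U, P)` at `y = c • z`
    have key := h.profile_eq (c • z)
    have hΔ : (Δ (fun w => c⁻¹ • U (c • w))) z = (c⁻¹ * c ^ 2) • (Δ U) (c • z) :=
      laplacian_const_smul_comp_smul U c⁻¹ hc0 z
    have hD : fderiv ℝ (fun w => c⁻¹ • U (c • w)) z = (c⁻¹ * c) • fderiv ℝ U (c • z) :=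
      fderiv_const_smul_comp_smul' U c⁻¹ c z
    have hG : gradient (fun w => (c ^ 2)⁻¹ * P (c • w)) z = ((c ^ 2)⁻¹ * c) • gradient P (c • z) :=
      gradient_const_mul_comp_smul P _ c z
    have hcc : c⁻¹ * c = 1 := inv_mul_cancel₀ hc0
    have hcc2 : c⁻¹ * c ^ 2 = c := by field_simp
    have hcc3 : (c ^ 2)⁻¹ * c = c⁻¹ := by field_simp
    simp only [convect] at key ⊢
    rw [hΔ, hD, hG, hcc, hcc2, hcc3, one_smul, one_smul]
    -- `DU(y)(c⁻¹ • U y) = c⁻¹ • DU(y)(U y)` and `DU(y) z = c⁻¹ • DU(y) (c • z)`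
    have e1 : (fderiv ℝ U (c • z)) (c⁻¹ • U (c • z)) = c⁻¹ • (fderiv ℝ U (c • z)) (U (c • z)) :=
      ContinuousLinearMap.map_smul _ _ _
    have e2 : (fderiv ℝ U (c • z)) z = c⁻¹ • (fderiv ℝ U (c • z)) (c • z) := by
      rw [ContinuousLinearMap.map_smul, smul_smul, hcc, one_smul]
    have key' := congrArg (fun v => c⁻¹ • v) key
    simp only [smul_add, smul_neg, smul_smul, smul_zero] at key'
    rw [hcc2, mul_comm c⁻¹ a] at key'
    rw [e1, e2, smul_smul, smul_smul]
    exact key'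
  · -- `div V = 0`
    show VectorCalculus.divergence (fun y => c⁻¹ • U (c • y)) z = 0
    rw [divergence_const_smul_comp_smul, h.divFree (c • z), mul_zero]

/-- `L^p` under a dilation of a finite-dimensional space (Lebesgue measure): `y ↦ g(S y)` is in
`L^p` when `g` is, `S ≠ 0` (Mathlib's `integrable_comp_smul_iff` for `L^p`). [folklore] -/
theorem memLp_comp_smul {X : Type*} [NormedAddCommGroup X] [NormedSpace ℝ X] [MeasurableSpace X]
    [BorelSpace X] [FiniteDimensional ℝ X] {μ : Measure X} [μ.IsAddHaarMeasure] {F : Type*}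
    [NormedAddCommGroup F] {g : X → F} {p : ℝ≥0∞} (hg : MemLp g p μ) {S : ℝ} (hS : S ≠ 0) :
    MemLp (fun x => g (S • x)) p μ := by
  have h1 : MemLp g p (Measure.map (fun x : X => S • x) μ) := by
    rw [Measure.map_addHaar_smul μ hS]
    exact hg.smul_measure ENNReal.ofReal_ne_top
  exact h1.comp_of_map (measurable_const_smul S).aemeasurable

end NuNormalise

/-- **NRŠ's Theorem 1 follows from its case `ν = 1`** (normalisation of the viscosity,
`IsLerayProfile.nu_normalise`, with `c = √ν`: `V(z) = c⁻¹ U(c z)` is again in `L³`, and `V = 0`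
forces `U = 0`). [cite: NecasRuzickaSverak1996, Thm 1 (p. 291); Tsai1998, §3.3 (p. 39)] -/
theorem necas_ruzicka_sverak_of_nu_one
    (h1 : ∀ {a : ℝ}, 0 < a → ∀ {U : ℝ³ → ℝ³} {P : ℝ³ → ℝ},
      IsLerayProfile 1 a U P → MemLp U 3 volume → U = 0) :
    necas_ruzicka_sverak := by
  intro ν a hν ha U P hprof hU3
  set c : ℝ := Real.sqrt ν with hc
  have hc0 : 0 < c := Real.sqrt_pos.2 hν
  have hc2 : c ^ 2 = ν := Real.sq_sqrt hν.le
  rw [← hc2] at hprof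
  have hV := hprof.nu_normalise hc0
  have hV3 : MemLp (fun z : ℝ³ => c⁻¹ • U (c • z)) 3 volume :=
    (memLp_comp_smul hU3 hc0.ne').const_smul c⁻¹
  have hV0 := h1 ha hV hV3
  funext y
  have := congr_fun hV0 (c⁻¹ • y)
  simp only [smul_smul, mul_inv_cancel₀ hc0.ne', one_smul, Pi.zero_apply, smul_eq_zero,
    inv_eq_zero, hc0.ne', false_or] at this
  exact this

/-! ### The conclusion of the one-scale criterion at `ν = 1` from `RRS2016.theorem15_3` -/

/-- **The one-scale ε-regularity criterion for the accepted suitable class at `ν = 1`, zero force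
and every radius, from Robinson–Rodrigo–Sadowski's Thm. 15.3** (Caffarelli–Kohn–Nirenberg 1982,
Proposition 1 and §2). Granted `RRS2016.theorem15_3`, there are `ε₀, C₀ > 0` such that: if
`(u, p)` is a suitable weak solution (`IsSuitableWeakSolutionOn`, force `0`, `ν = 1`) on an open
region `Q ⊆ ℝ × ℝ³`, `z₀ = (t₀, x₀)`, `0 < r₀ ≤ r₁`, the closed box `[t₀ − r₁², t₀] × B̄_{r₁}(x₀)` lies
in `Q`, and `∫∫_{Q_{r₀}(z₀)} (|u|³ + |p|^{3/2}) ≤ ε₀³ r₀²`, then `|u| ≤ C₀ ε₀ / r₀` a.e. on `Q_{r₀/2}(z₀)`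
— the hypothesis `H` of `IsLerayProfile.exists_forall_norm_mul_norm_le_of_oneScale` at `ν = 1`.
Proof: module docstring (localisation to `Ω = Q_{r₁}(z₀)`, Navier–Stokes scaling to the unit
cylinder, `IsLRSuitableWeakSolutionOn.isSuitablePair`, Thm. 15.3 with `ε₀³ ≤ ε₀*`, transport
back). [cite: RobinsonRodrigoSadowski2016, Thm. 15.3 p. 220; CaffarelliKohnNirenberg1982, §2 and Proposition 1] -/
theorem epsilonRegularity_one_of_theorem15_3 (h15 : RRS2016.theorem15_3) :
    ∃ ε₀ C₀ : ℝ, 0 < ε₀ ∧ 0 < C₀ ∧ ∀ (Q : Opens (ℝ × ℝ³)) (u : ℝ → ℝ³ → ℝ³) (p : ℝ → ℝ³ → ℝ),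
      IsSuitableWeakSolutionOn Q 1 0 u p →
      ∀ (z₀ : ℝ × ℝ³) (r₀ r₁ : ℝ), 0 < r₀ → r₀ ≤ r₁ →
        Icc (z₀.1 - r₁ ^ 2) z₀.1 ×ˢ closedBall z₀.2 r₁ ⊆ (Q : Set (ℝ × ℝ³)) →
        ∫⁻ w in parabolicCylinder r₀ z₀, (‖u w.1 w.2‖ₑ ^ (3 : ℕ) + ‖p w.1 w.2‖ₑ ^ (3 / 2 : ℝ)) ≤
          ENNReal.ofReal (ε₀ ^ 3 * r₀ ^ 2) →
        ∀ᵐ w ∂(volume.restrict (parabolicCylinder (r₀ / 2) z₀)), ‖u w.1 w.2‖ ≤ C₀ * ε₀ / r₀ := by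
  obtain ⟨ε₁, cM, hε₁, hcM, H⟩ := h15
  set ε₀ : ℝ := min ε₁ 1 with hε₀def
  have hε₀ : 0 < ε₀ := lt_min hε₁ one_pos
  have hε₀1 : ε₀ ≤ 1 := min_le_right _ _
  have hε₀3 : ε₀ ^ 3 ≤ ε₁ :=
    (pow_le_of_le_one hε₀.le hε₀1 three_ne_zero).trans (min_le_left _ _)
  refine ⟨ε₀, cM, hε₀, hcM, fun Q u p hsws z₀ r₀ r₁ hr₀ hr₀₁ hKQ hsmall => ?_⟩
  have hr₁ : 0 < r₁ := hr₀.trans_le hr₀₁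
  -- ## localisation: the §14.3 hypotheses on `Ω = Q_{r₁}(z₀)`
  set K : Set (ℝ × ℝ³) := Icc (z₀.1 - r₁ ^ 2) z₀.1 ×ˢ closedBall z₀.2 r₁ with hK
  have hKc : IsCompact K := isCompact_Icc.prod (isCompact_closedBall _ _)
  set Ω : Opens (ℝ × ℝ³) := parabolicCylinderOpens r₁ z₀ with hΩdef
  have hΩ : (Ω : Set (ℝ × ℝ³)) = parabolicCylinder r₁ z₀ := rfl
  have hΩK : (Ω : Set (ℝ × ℝ³)) ⊆ K := by
    rw [hΩ]
    show Ioo (z₀.1 - r₁ ^ 2) z₀.1 ×ˢ ball z₀.2 r₁ ⊆ Icc (z₀.1 - r₁ ^ 2) z₀.1 ×ˢ closedBall z₀.2 r₁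
    exact prod_mono Ioo_subset_Icc_self ball_subset_closedBall
  have hΩQ' : (Ω : Set (ℝ × ℝ³)) ⊆ (Q : Set (ℝ × ℝ³)) := hΩK.trans hKQ
  have hΩQ : Ω ≤ Q := hΩQ'
  obtain ⟨G, hG, hGL2, hLE⟩ := hsws.localEnergy
  obtain ⟨Cu, hCu⟩ := hsws.energyClass K hKQ hKc
  have hpK := hsws.pressure K hKQ hKc
  have hdist : IsDistributionalNSSolutionOn Ω 1 0 u p := hsws.distributional.of_le hΩQ
  have hE : ∃ C : ℝ≥0, ∀ᵐ t : ℝ,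
      ∫⁻ x, (Ω : Set (ℝ × ℝ³)).indicator (fun z : ℝ × ℝ³ => ‖u z.1 z.2‖ₑ ^ 2) (t, x) ≤ C := by
    refine ⟨Cu, ?_⟩
    filter_upwards [hCu] with t ht
    refine (lintegral_mono fun x => ?_).trans ht
    exact indicator_le_indicator_of_subset hΩK (fun _ => zero_le) _
  have hGΩ : ∫⁻ w in (Ω : Set (ℝ × ℝ³)), ENNReal.ofReal (frobeniusNormSq (G w.1 w.2)) < ⊤ :=
    (lintegral_mono_set hΩK).trans_lt (hGL2 K hKQ hKc)
  have hpΩ : ∫⁻ w in (Ω : Set (ℝ × ℝ³)), ‖p w.1 w.2‖ₑ ^ (3 / 2 : ℝ) < ⊤ :=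
    (lintegral_mono_set hΩK).trans_lt hpK
  have hfΩ : MemLp (uncurry (0 : ℝ → ℝ³ → ℝ³)) (ENNReal.ofReal 3)
      (volume.restrict (Ω : Set (ℝ × ℝ³))) :=
    (MemLp.zero : MemLp (0 : ℝ × ℝ³ → ℝ³) (ENNReal.ofReal 3)
      (volume.restrict (Ω : Set (ℝ × ℝ³))))
  have hLEΩ : ∀ φ : ℝ → ℝ³ → ℝ, IsSpaceTimeTestOn Ω φ → (∀ t x, 0 ≤ φ t x) →
      2 * (1 : ℝ) * ∫ t, ∫ x, frobeniusNormSq (G t x) * φ t x ≤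
        ∫ t, ∫ x, (‖u t x‖ ^ 2 * (timeDeriv φ t x + 1 * Δ (φ t) x) +
          (‖u t x‖ ^ 2 + 2 * p t x) * ⟪u t x, gradient (φ t) x⟫ +
          2 * ⟪(0 : ℝ → ℝ³ → ℝ³) t x, u t x⟫ * φ t x) :=
    fun φ hφ hφ0 => hLE φ (hφ.mono hΩQ) hφ0
  have hS : IsLRSuitableWeakSolutionOn Ω 1 3 0 u p G :=
    ⟨by rw [hΩ]; exact parabolicCylinder_isConnected hr₁ z₀, hE, hG.mono hΩQ, hGΩ, hpΩ, hfΩ, hdist,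
      hLEΩ⟩
  have hcyl : parabolicCylinder r₀ z₀ ⊆ (Ω : Set (ℝ × ℝ³)) := by
    rw [hΩ]
    show Ioo (z₀.1 - r₀ ^ 2) z₀.1 ×ˢ ball z₀.2 r₀ ⊆ Ioo (z₀.1 - r₁ ^ 2) z₀.1 ×ˢ ball z₀.2 r₁
    have hsq : r₀ ^ 2 ≤ r₁ ^ 2 := pow_le_pow_left₀ hr₀.le hr₀₁ 2
    exact prod_mono (Ioo_subset_Ioo (by linarith) le_rfl) (ball_subset_ball hr₀₁)
  -- ## the Navier–Stokes scaling to the unit cylinder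
  have hβ0 : (0 : ℝ) < r₀ ^ 2 := by positivity
  have hS' := hS.nsRescale hr₀ z₀.1 z₀.2
  have hf0 : (r₀ ^ 2 * r₀) • stPull (r₀ ^ 2) r₀ z₀.1 z₀.2 (0 : ℝ → ℝ³ → ℝ³) = 0 := by
    funext s y
    rw [smul_stPull_apply]
    simp
  rw [hf0] at hS'
  set Φ := stAffine (r₀ ^ 2) r₀ z₀.1 z₀.2 with hΦ
  have hpre : ∀ ρ : ℝ, Φ ⁻¹' parabolicCylinder ρ z₀ = parabolicCylinder (ρ / r₀) (0 : ℝ × ℝ³) :=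
    fun ρ => stAffine_sq_preimage_parabolicCylinder hr₀ z₀ ρ
  have hpre1 : Φ ⁻¹' parabolicCylinder r₀ z₀ = parabolicCylinder 1 (0 : ℝ × ℝ³) := by
    rw [hpre, div_self hr₀.ne']
  have hpre2 : Φ ⁻¹' parabolicCylinder (r₀ / 2) z₀ = parabolicCylinder (1 / 2) (0 : ℝ × ℝ³) := by
    rw [hpre]
    congr 1
    field_simp
  have h1 : parabolicCylinder 1 (0 : ℝ × ℝ³) ⊆
      ((stPreimage (r₀ ^ 2) r₀ z₀.1 z₀.2 Ω : Opens (ℝ × ℝ³)) : Set (ℝ × ℝ³)) := by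
    rw [coe_stPreimage, ← hpre1]
    exact preimage_mono hcyl
  -- the rescaled datum is a suitable pair on `Q_1(0, 0)` (zero force is solenoidal)
  have hP := hS'.isSuitablePair (by norm_num) (fun φ _ => by simp) h1
  -- the Jacobian factor `(r₀² · r₀³)⁻¹ = r₀⁻⁵`
  have hJ : ENNReal.ofReal (r₀ ^ 2 * r₀ ^ Module.finrank ℝ ℝ³)⁻¹ = ENNReal.ofReal (r₀ ^ 5)⁻¹ := by
    rw [finrank_euclideanSpace_three]
    congr 1
    ring
  -- ## smallness of `(w, π)` on `Q_1(0, 0)`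
  have h2 : RRS2016.Small (ε₀ ^ 3) (r₀ • stPull (r₀ ^ 2) r₀ z₀.1 z₀.2 u)
      (r₀ ^ 2 • stPull (r₀ ^ 2) r₀ z₀.1 z₀.2 p) (0 : ℝ × ℝ³) := by
    unfold RRS2016.Small
    set Fs : ℝ × ℝ³ → ℝ≥0∞ := fun z => ‖u z.1 z.2‖ₑ ^ (3 : ℕ) + ‖p z.1 z.2‖ₑ ^ (3 / 2 : ℝ)
      with hFs
    have hpt : ∀ w : ℝ × ℝ³,
        ‖(r₀ • stPull (r₀ ^ 2) r₀ z₀.1 z₀.2 u) w.1 w.2‖ₑ ^ (3 : ℕ) +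
          ‖(r₀ ^ 2 • stPull (r₀ ^ 2) r₀ z₀.1 z₀.2 p) w.1 w.2‖ₑ ^ (3 / 2 : ℝ) =
        ENNReal.ofReal (r₀ ^ 3) * Fs (Φ w) := by
      intro w
      rw [smul_stPull_apply, smul_stPull_apply, enorm_smul, enorm_smul, mul_pow,
        ENNReal.mul_rpow_of_nonneg _ _ (by norm_num), Real.enorm_eq_ofReal hr₀.le,
        Real.enorm_eq_ofReal hβ0.le, ← ENNReal.ofReal_pow hr₀.le,
        ENNReal.ofReal_rpow_of_nonneg hβ0.le (by norm_num), sq_rpow_threeHalves hr₀.le, hFs,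
        mul_add]
      rfl
    simp_rw [hpt]
    rw [lintegral_const_mul' _ _ ENNReal.ofReal_ne_top, ← hpre1,
      setLIntegral_preimage_comp_stAffine hβ0 hr₀ z₀.1 z₀.2 Fs, hJ]
    calc ENNReal.ofReal (r₀ ^ 3) *
          (ENNReal.ofReal (r₀ ^ 5)⁻¹ * ∫⁻ z in parabolicCylinder r₀ z₀, Fs z)
        ≤ ENNReal.ofReal (r₀ ^ 3) *
            (ENNReal.ofReal (r₀ ^ 5)⁻¹ * ENNReal.ofReal (ε₀ ^ 3 * r₀ ^ 2)) := by
          gcongr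
      _ = ENNReal.ofReal (ε₀ ^ 3) := by
          rw [← ENNReal.ofReal_mul (by positivity), ← ENNReal.ofReal_mul (by positivity)]
          congr 1
          field_simp
  -- ## Thm. 15.3 on `Q_1(0, 0)` and transport back along `Φ`
  have key := H 0 _ _ _ hP (ε₀ ^ 3) (pow_pos hε₀ 3) hε₀3 h2
  have hε13 : (ε₀ ^ 3) ^ (1 / 3 : ℝ) = ε₀ := by
    rw [← Real.rpow_natCast, ← Real.rpow_mul hε₀.le]
    norm_num
  rw [hε13, ← hpre2] at key
  have key' := ae_restrict_of_ae_restrict_preimage_stAffine hβ0 hr₀ z₀.1 z₀.2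
    (S := parabolicCylinder (r₀ / 2) z₀) (P := fun z => ‖r₀ • u z.1 z.2‖ ≤ cM * ε₀) key
  filter_upwards [key'] with z hz
  rw [norm_smul, Real.norm_eq_abs, abs_of_pos hr₀] at hz
  rw [le_div_iff₀ hr₀]
  linarith

/-! ### The assembly -/

/-- **NRŠ 1996, Theorem 1 at `ν = 1`, from the conclusion of the one-scale criterion at `ν = 1`.**
Given constants `ε₀ > 0`, `C₀` with the property `H` of
`IsLerayProfile.exists_forall_norm_mul_norm_le_of_oneScale` at `ν = 1`, every Leray profile
`(U, P)` with viscosity `1`, rate `a > 0` and `U ∈ L³(ℝ³)` vanishes: `U` is smooth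
(`tsai1998_profile_smooth_holds`), `P − c ∈ L^{3/2}` for a constant `c` (`nrs1996_lemma31_holds`),
so `|y| |U(y)| ≤ C` far out (NRŠ (3.6), `k = 0`), hence `|U(y)| ≤ (a/2)|y|` far out; with the
polynomial growth of the pressure (`tsai1998_lemma32_of_facts`, from the discharged Stokes and
Stein estimates) the proved endgame `IsLerayProfile.eq_zero_of_growth` (NRŠ Lemma 3.3 / Tsai's
Lemma 5.1, `ΔU = 0`, the harmonic Liouville theorem in `L³`) gives `U = 0`. [cite: NecasRuzickaSverak1996, Thm 1 (p. 291)] -/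
theorem necas_ruzicka_sverak_nu_one_of_oneScale {ε₀ C₀ : ℝ} (hε₀ : 0 < ε₀)
    (H : ∀ (Q : Opens (ℝ × ℝ³)) (u : ℝ → ℝ³ → ℝ³) (p : ℝ → ℝ³ → ℝ),
      IsSuitableWeakSolutionOn Q 1 0 u p →
      ∀ (z₀ : ℝ × ℝ³) (r₀ r₁ : ℝ), 0 < r₀ → r₀ ≤ r₁ →
        Icc (z₀.1 - r₁ ^ 2) z₀.1 ×ˢ closedBall z₀.2 r₁ ⊆ (Q : Set (ℝ × ℝ³)) →
        ∫⁻ w in parabolicCylinder r₀ z₀, (‖u w.1 w.2‖ₑ ^ (3 : ℕ) + ‖p w.1 w.2‖ₑ ^ (3 / 2 : ℝ)) ≤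
          ENNReal.ofReal (ε₀ ^ 3 * r₀ ^ 2) →
        ∀ᵐ w ∂(volume.restrict (parabolicCylinder (r₀ / 2) z₀)), ‖u w.1 w.2‖ ≤ C₀ * ε₀ / r₀)
    {a : ℝ} (ha : 0 < a) {U : ℝ³ → ℝ³} {P : ℝ³ → ℝ} (hprof : IsLerayProfile 1 a U P)
    (hU3 : MemLp U 3 volume) : U = 0 := by
  obtain ⟨c, hPc⟩ := nrs1996_lemma31_holds one_pos ha hprof hU3
  obtain ⟨C, R, hdecay⟩ := hprof.exists_forall_norm_mul_norm_le_of_oneScale ha hε₀ H hU3 hPc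
  have hU3' : ContDiff ℝ 3 U := contDiff_infty.1 (tsai1998_profile_smooth_holds one_pos ha hprof) 3
  have hP2 : ContDiff ℝ 2 P := hprof.contDiff_two_pressure hU3'
  obtain ⟨N, C', R', hPR⟩ := tsai1998_lemma32_of_facts tsai1998_profile_smooth_holds
    stokes_interior_Lr_estimate_holds stein1970_normalisedPressure_Lp_bound_holds one_pos ha hprof
    (le_refl _) hU3
  -- `|y| |U(y)| ≤ C` for `|y| ≥ R` gives `|U(y)| ≤ (a/2)|y|` for `|y| ≥ max (max R 1) (2|C|/a)`
  have hUb : ∀ y : ℝ³, max (max R 1) (2 * |C| / a) ≤ ‖y‖ → ‖U y‖ ≤ a / 2 * ‖y‖ := by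
    intro y hy
    have hR : R ≤ ‖y‖ := le_trans (le_trans (le_max_left _ _) (le_max_left _ _)) hy
    have h1 : 1 ≤ ‖y‖ := le_trans (le_trans (le_max_right _ _) (le_max_left _ _)) hy
    have h2 : 2 * |C| / a ≤ ‖y‖ := le_trans (le_max_right _ _) hy
    have h2' : 2 * |C| ≤ a * ‖y‖ := by rwa [div_le_iff₀' ha] at h2
    have hd : ‖y‖ * ‖U y‖ ≤ |C| := (hdecay y hR).trans (le_abs_self C)
    have h3 : ‖y‖ * ‖U y‖ ≤ ‖y‖ * (a / 2) := by nlinarith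
    have h4 : ‖U y‖ ≤ a / 2 := le_of_mul_le_mul_left h3 (by linarith)
    nlinarith
  exact hprof.eq_zero_of_growth one_pos ha hU3' hP2 (half_pos ha).le (half_lt_self ha) hUb hPR
    (by norm_num) ENNReal.ofNat_ne_top hU3

/-- **NRŠ 1996, Theorem 1, from Robinson–Rodrigo–Sadowski's Thm. 15.3** (Caffarelli–Kohn–Nirenberg's
Proposition 1 for suitable pairs, `ν = 1`, unit cylinder, zero force): every Leray profile
`U ∈ L³(ℝ³)` (`ν, a > 0`) vanishes. Normalise `ν = 1` (`necas_ruzicka_sverak_of_nu_one`) and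
combine `epsilonRegularity_one_of_theorem15_3` with `necas_ruzicka_sverak_nu_one_of_oneScale`.
[cite: NecasRuzickaSverak1996, Thm 1 (p. 291); RobinsonRodrigoSadowski2016, Thm. 15.3 p. 220] -/
theorem necas_ruzicka_sverak_of_theorem15_3 (h15 : RRS2016.theorem15_3) : necas_ruzicka_sverak := by
  obtain ⟨ε₀, C₀, hε₀, -, H⟩ := epsilonRegularity_one_of_theorem15_3 h15
  exact necas_ruzicka_sverak_of_nu_one fun ha _ _ hprof hU3 =>
    necas_ruzicka_sverak_nu_one_of_oneScale hε₀ H ha hprof hU3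

/-- **NRŠ 1996, Theorem 1, from the two remaining named steps of Robinson–Rodrigo–Sadowski's
proof of Thm. 15.3** — Step 2 of the induction (`RRS2016.step2_force`) and the local pressure
estimate, Lemma 15.12 (`RRS2016.lemma15_12`) —, everything else (Steps 1, 3, 4, the interpolation
inequality, the scaling, the Riesz pressure, the Stokes and Calderón–Zygmund estimates behind
Tsai's Lemma 3.2, the regularity of profiles, the head-pressure identity, Tsai's Liouville lemma
and the harmonic Liouville theorem) being proved in the tree: this is the current trust base of
`necas_ruzicka_sverak`. [cite: NecasRuzickaSverak1996, Thm 1 (p. 291); RobinsonRodrigoSadowski2016, proof of Thm. 15.3 (pp. 220–226) and Lemma 15.12] -/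
theorem necas_ruzicka_sverak_of_RRS_steps (h2 : RRS2016.step2_force) (h12 : RRS2016.lemma15_12) :
    necas_ruzicka_sverak :=
  necas_ruzicka_sverak_of_theorem15_3 (RRS2016.theorem15_3_of_step2 h2 h12)

/-- **NRŠ 1996, Theorem 1, from Lemarié-Rieusset's Thm. 14.4 alone**: the accepted chain
`necas_ruzicka_sverak_of_CKN` with the regularity of profiles (`tsai1998_profile_smooth_holds`) and
Tsai's Lemma 3.2 (`tsai1998_lemma32_of_facts` fed by `stokes_interior_Lr_estimate_holds` and
`stein1970_normalisedPressure_Lp_bound_holds`) discharged. [cite: NecasRuzickaSverak1996, Thm 1 (p. 291); LemarieRieusset2016, Thm. 14.4 (p. 505)] -/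
theorem necas_ruzicka_sverak_of_LR (hLR : lemarieRieusset_epsilon_regularity) :
    necas_ruzicka_sverak :=
  necas_ruzicka_sverak_of_CKN tsai1998_profile_smooth_holds
    (tsai1998_lemma32_of_facts tsai1998_profile_smooth_holds stokes_interior_Lr_estimate_holds
      stein1970_normalisedPressure_Lp_bound_holds) hLR

end Literature.Analysis.FluidPDE

end
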